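import Mathlib.Analysis.Calculus.MeanValue
import Mathlib.Analysis.Complex.RealDeriv
import Summits.QuantumFields.BalabanUV.T4Continuum.Support.NE9Lemma1RemainderSpecies

/-!
# NE9RealSliceSourcingNoGo — the background slot of row NE9's END of record is a COMPLEX chart, and it cannot be filled from REAL
# configurations: a member of the analytic class whose chart function is sourced from the real slice is background-CONSTANT on every
# chart ball (cell `pub-balaban`, T4-DAG §2 node U3 ∕ §6 NE9; BINDER row NE9 OWNER lineage `b2b-balaban-t4-ne9-p1`, gen 30,
# prover-b2b-balaban-t4-ne9-p1-g30-0; owner finding OBJ-NE9-g30-1 «COMPLEX BACKGROUND SLOT», sheet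
# `t4/b2b-balaban-t4-ne9-p1/g30/CPLX-SLOT-NE9-g30.md`; located self-correction O-ne9p1g30-1 of the lineage's (δ) instantiation sentence)

HONEST FRAMING (T4-DAG PAGE 1).  Rung (B)+1 of the FINITE-VOLUME T⁴ continuum programme — NOT infinite volume, NOT a mass gap, NOT
the Clay problem, NOT a proof of NE9 (NE9 is a cell NEW ESTIMATE, NOT PRINTED in [Balaban1987RG1]–[Balaban1989LargeFieldII]; spine
PROVED 0∕9; 0∕18 NE9 leaves instantiated on Bałaban's objects).  HONEST DEPENDENCY (cell line, verbatim): continuum YM on T⁴ ⇐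
BetaPertH ∧ nine spine estimates (0/9 proved); BetaPertH ⇐ (D1) ∧ (D4) ∧ CAP+tail; G-an2-4 gates asym, D1 and NE2/3/4.
`FlowStep.BetaPertH`, (B), (B^μ) do not occur.  Summits-side bookkeeping under the LEAN PLACEMENT RULE: elementary complex analysis
over Mathlib + one corollary over the lineage's own `NE9Lemma1RemainderSpecies.analyticClass`; 0 estimate about Bałaban's objects,
no `def … : Prop` fact about them, nothing printed asserted.

WHY THIS FILE.  Row NE9's END of record (`NE9SizeFedCouplingSpeciesReadOut.termSize_ne9_and_fadingMemory_species_margProj_fedA3`,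
p216114) is typed over a background slot `E` with `[NormedAddCommGroup E] [NormedSpace ℂ E]`: the term functional is
`Ef : Functional (doubleCarriers C₀) E`, the activity `act : ℕ → ℝ → E → Pot → G.P → ℂ`, the vacuum `U₀ : E`, and the admissible
marginal-free class satisfies `hMF : MF ⊆ analyticClass D.R` with
`analyticClass R = {H | ∀ X, DifferentiableOn ℂ (lift H X) (ball 0 (R X))}` (`NE9Lemma1RemainderSpecies` §1) — the background slot IS
the COMPLEX chart of the small-field space ([Balaban1987RG1] (1.18) p. 263: 𝐄^{(j)}(X, ·) «defined and analytic on the space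
U^c_j(X, α₀, α₁)»; [Balaban1985BackgroundPropagators] Sect. B pp. 399–400, Theorem 3.4: the operators «extend to configurations U′U»,
U′ = e^{iηA}, A with values in the complexified Lie algebra 𝔤ᶜ, «as analytic functions of A»), exactly as the skeleton's TYPING NOTE
(`SKELETON-NE9-P1.md` v1.3 l. 137–139) and `NE9ComplexEncoding` (p209236) say; the consumer's real-background NE9 is the pull-back
`NE9ComplexEncoding.ne9_comap` along the inclusion of real configurations.  The substrate's step of record reads REAL configurations:
`B13StepOfRecord.Slots.rawB : (ℕ → ℝ) → R.carriers.BgB → ℕ → E′ → ℂ` with `R.carriers.BgB = ↥R.admB`,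
`R.admB : Set (GaugeField (F.P (K+1)) 0 G)`, `[GaugeGroup G]` (axiom `reTr_le_one`: the compact form, no instance models 𝔘^c), and the
lineage's own consumption faces source NE9's operator datum from that slot (`U3PolymerDictionaryNE9FaceD6.oRecLast S : ℕ → ℝ →
R.carriers.BgB → …`, p219089).  Hence the instantiation sentence of record «END T4 at `act := actNE9 S (oRecLast S) (iRecLast S)`» is
ILL-TYPED (`↥R.admB` carries no `NormedSpace ℂ`), and the question is whether a CHEAP repair exists: keep the substrate's real-slice
species and DEFINE the chart activity ∕ term functional on the complex chart `E` by reading only the real part of the chart coordinate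
(any map `E → ↥R.admB` constant along the imaginary directions of a real form of `E`).  THIS FILE SHOWS THE CHEAP REPAIR IS VACUOUS:
every member of `analyticClass R` so sourced is CONSTANT in the background on each chart ball (§2–§3), so the END's class binders
(`hMF`, `hPinto`, `hAdm`) would admit only background-trivial families — not Bałaban's terms.  What an honest instantiation needs
instead is recorded in the sheet (request D-8 to the substrate: the kernel∕potential species as HOLOMORPHIC functions of complexified
transporter data, `U† ↦ U⁻¹`, [Balaban1985BackgroundPropagators] (3.50)–(3.53) p. 400 and the parenthesis p. 406 «for complex
configurations A the operator F*(A) is not the adjoint of F(A)»).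

WHAT IS PROVED (kernel; elementary, `[folklore]`).
* §1 the two hypothesis SHAPES, kept INLINE (no `def … : Prop`): a real form `S` of the chart (every chart vector is `u + I•v`,
  `u, v ∈ S`) and real-slice sourcing (invariance of `f` on `B` under the imaginary translations `((t:ℂ)·I)•v`, `v ∈ S`, that stay
  in `B`); the model real form of `ι → ℂ` (`realForm_pi`) and the model sourcing «`f` factors through the coordinatewise real part»
  (`realSliceSourced_of_factor_re`).
* §2 `fderiv_apply_I_smul_eq_zero` ∕ `fderiv_eq_zero_of_realSliceSourced`: on an open set a ℂ-differentiable real-slice-sourced `f` has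
  `fderiv ℂ f = 0` (the derivative along `I•v` vanishes by invariance, along `v` by complex linearity); `is_const_of_realSliceSourced` ∕
  `_ball`: hence `f` is constant on a preconnected open set ∕ on a ball (Mathlib's `IsOpen.is_const_of_fderiv_eq_zero`).
* §3 THE ROW-NE9 COROLLARY `analyticClass_const_of_realSliceSourced`: a family `H ∈ analyticClass R` on the doubled carriers whose chart
  functions are real-slice sourced satisfies `H A (X, b) = H A′ (X, b)` for all `A, A′` in the chart ball of
  `X` — both the real-part and the imaginary-part copies are background-constant; model instance `analyticClass_const_of_factor_re`
  (chart `ι → ℂ`, families reading only `Re`).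
DISGUISE TEST: identity-theorem bookkeeping; no two-history statement, no estimate; not NE9.

References (TYPES ∕ loci only): [Balaban1987RG1] T. Bałaban, CMP **109** (1987) 249–301, (1.2) p. 260, (1.18) p. 263;
[Balaban1985BackgroundPropagators] T. Bałaban, CMP **99** (1985) 389–434, Sect. B pp. 399–400, Theorem 3.4 p. 400, (3.50)–(3.53), p. 406;
[Balaban1988RG2Cluster] T. Bałaban, CMP **116** (1988) 1–22, (1.23)–(1.24) p. 7 («we represent all derivatives by the Cauchy formula»).
-/

noncomputable section

namespace Summit.QuantumFields.BalabanUV.T4Continuum.NE9RealSliceSourcingNoGo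

open Metric Set Filter Topology Complex
open Literature.MathematicalPhysics.QuantumFieldTheory.Balaban1983to89.T4OutputRate (Carriers)
open Summit.QuantumFields.BalabanUV.T4Continuum.NE9ComplexEncoding (doubleCarriers)
open Summit.QuantumFields.BalabanUV.T4Continuum.NE9Lemma1RemainderSpecies (analyticClass lift)

/-! ## §1 Real forms of the complex chart and real-slice sourcing -/

section General

variable {E : Type*} [NormedAddCommGroup E] [NormedSpace ℂ E]

/-! TWO HYPOTHESIS SHAPES, kept INLINE in every statement (no `def … : Prop` is minted):
* REAL FORM of the chart, a set `S` of «real directions»: `∀ w : E, ∃ u ∈ S, ∃ v ∈ S, w = u + I • v` (no linearity or uniqueness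
  is required for the no-go);
* REAL-SLICE SOURCED `f` on `B` w.r.t. `S`: `∀ A ∈ B, ∀ v ∈ S, ∀ t : ℝ, A + (t·I) • v ∈ B → f (A + (t·I) • v) = f A` — invariance
  under the imaginary translations that stay inside `B`; the shape of «the chart activity reads only the real configuration under
  the chart point». -/

/-- [folklore] THE MODEL REAL FORM of the coordinate chart `ι → ℂ`: the real coordinate vectors — every `w` is `Re w + I • Im w`. -/
theorem realForm_pi (ι : Type*) [Fintype ι] (w : ι → ℂ) :
    ∃ u ∈ Set.range (fun r : ι → ℝ => fun i => (r i : ℂ)), ∃ v ∈ Set.range (fun r : ι → ℝ => fun i => (r i : ℂ)),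
      w = u + (I : ℂ) • v := by
  refine ⟨fun i => ((w i).re : ℂ), ⟨fun i => (w i).re, rfl⟩, fun i => ((w i).im : ℂ), ⟨fun i => (w i).im, rfl⟩, ?_⟩
  funext i
  simp only [Pi.add_apply, Pi.smul_apply, smul_eq_mul]
  rw [mul_comm]
  exact (Complex.re_add_im (w i)).symm

/-- [folklore] THE MODEL SOURCING: a chart function that FACTORS THROUGH THE COORDINATEWISE REAL PART is real-slice sourced on every
set (the cheap repair «activity at the chart point := activity at the real configuration under it»). -/
theorem realSliceSourced_of_factor_re {ι : Type*} [Fintype ι] (B : Set (ι → ℂ)) (g : (ι → ℝ) → ℂ) :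
    ∀ A ∈ B, ∀ v ∈ Set.range (fun r : ι → ℝ => fun i => (r i : ℂ)), ∀ t : ℝ, A + ((t : ℂ) * I) • v ∈ B →
      (fun w : ι → ℂ => g fun i => (w i).re) (A + ((t : ℂ) * I) • v) = (fun w : ι → ℂ => g fun i => (w i).re) A := by
  intro A _ v hv t _
  obtain ⟨r, rfl⟩ := hv
  dsimp only
  congr 1
  funext i
  simp

end General

/-! ## §2 A ℂ-differentiable real-slice-sourced function is constant -/

section Const

variable {E : Type*} [NormedAddCommGroup E] [NormedSpace ℂ E]

/-- [folklore] Along an imaginary real-form direction the derivative of a real-slice-sourced differentiable function VANISHES: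
`fderiv ℂ f A (I • v) = 0` — the composite `t ↦ f (A + (t·I)•v)` is constant near `t = 0` (invariance on the open set `B`), and its
derivative at `0` is `fderiv ℂ f A (I • v)` (chain rule). -/
theorem fderiv_apply_I_smul_eq_zero {B : Set E} (hB : IsOpen B) {f : E → ℂ} (hf : DifferentiableOn ℂ f B) {S : Set E}
    (hinv : ∀ A ∈ B, ∀ v ∈ S, ∀ t : ℝ, A + ((t : ℂ) * I) • v ∈ B → f (A + ((t : ℂ) * I) • v) = f A)
    {A : E} (hA : A ∈ B) {v : E} (hv : v ∈ S) :
    fderiv ℂ f A ((I : ℂ) • v) = 0 := by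
  set γ : ℝ → E := fun t => A + ((t : ℂ) * I) • v with hγ
  have hγ0 : γ 0 = A := by simp [hγ]
  -- the curve's derivative at 0
  have h1 : HasDerivAt (fun t : ℝ => ((t : ℂ) * I)) ((1 : ℂ) * I) 0 := by
    have h0 : HasDerivAt (fun t : ℝ => (t : ℂ)) 1 0 := by
      simpa using (hasDerivAt_id (0 : ℝ)).ofReal_comp
    exact h0.mul_const I
  have hγ' : HasDerivAt γ (((1 : ℂ) * I) • v) 0 := by
    have h2 := (h1.smul_const v).const_add A
    simpa [hγ] using h2
  -- the chain rule over ℝ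
  have hfA : HasFDerivAt (𝕜 := ℝ) f ((fderiv ℂ f A).restrictScalars ℝ) (γ 0) := by
    rw [hγ0]
    exact ((hf.differentiableAt (hB.mem_nhds hA)).hasFDerivAt).restrictScalars ℝ
  have hcomp : HasDerivAt (f ∘ γ) (((fderiv ℂ f A).restrictScalars ℝ) (((1 : ℂ) * I) • v)) 0 :=
    hfA.comp_hasDerivAt (0 : ℝ) hγ'
  -- the composite is constant near 0
  have hcont : Continuous γ := by
    have : Continuous fun t : ℝ => ((t : ℂ) * I) := Complex.continuous_ofReal.mul continuous_const
    exact continuous_const.add (this.smul continuous_const)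
  have hnear : ∀ᶠ t in 𝓝 (0 : ℝ), γ t ∈ B := by
    have hBn : B ∈ 𝓝 (γ 0) := by rw [hγ0]; exact hB.mem_nhds hA
    exact hcont.continuousAt.preimage_mem_nhds hBn
  have hev : (f ∘ γ) =ᶠ[𝓝 (0 : ℝ)] fun _ => f A := by
    filter_upwards [hnear] with t ht
    exact hinv A hA v hv t ht
  have hzero : HasDerivAt (f ∘ γ) (0 : ℂ) 0 := (hasDerivAt_const (0 : ℝ) (f A)).congr_of_eventuallyEq hev
  have huniq := hcomp.unique hzero
  simpa using huniq

/-- [folklore] **THE DERIVATIVE VANISHES**: on an open set, a ℂ-differentiable function that is real-slice sourced with respect to a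
real form has `fderiv ℂ f A = 0` at every point (vanishing along `I • v` by §2's first lemma, along `v` by complex linearity
`L (I • v) = I · L v`, on all of `E = S + I • S` by additivity). -/
theorem fderiv_eq_zero_of_realSliceSourced {B : Set E} (hB : IsOpen B) {f : E → ℂ} (hf : DifferentiableOn ℂ f B) {S : Set E}
    (hS : ∀ w : E, ∃ u ∈ S, ∃ v ∈ S, w = u + (I : ℂ) • v)
    (hinv : ∀ A ∈ B, ∀ v ∈ S, ∀ t : ℝ, A + ((t : ℂ) * I) • v ∈ B → f (A + ((t : ℂ) * I) • v) = f A)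
    {A : E} (hA : A ∈ B) : fderiv ℂ f A = 0 := by
  have hI : ∀ v ∈ S, fderiv ℂ f A ((I : ℂ) • v) = 0 := fun v hv => fderiv_apply_I_smul_eq_zero hB hf hinv hA hv
  have hR : ∀ v ∈ S, fderiv ℂ f A v = 0 := by
    intro v hv
    have h := hI v hv
    rw [ContinuousLinearMap.map_smul, smul_eq_mul, mul_eq_zero] at h
    exact h.resolve_left I_ne_zero
  ext w
  obtain ⟨u, hu, v, hv, rfl⟩ := hS w
  simp [map_add, hR u hu, hR v hv]

/-- [folklore] **CONSTANCY** on a preconnected open set: a ℂ-differentiable real-slice-sourced function takes one value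
(Mathlib's `IsOpen.is_const_of_fderiv_eq_zero`). -/
theorem is_const_of_realSliceSourced {B : Set E} (hB : IsOpen B) (hBc : IsPreconnected B) {f : E → ℂ}
    (hf : DifferentiableOn ℂ f B) {S : Set E} (hS : ∀ w : E, ∃ u ∈ S, ∃ v ∈ S, w = u + (I : ℂ) • v)
    (hinv : ∀ A ∈ B, ∀ v ∈ S, ∀ t : ℝ, A + ((t : ℂ) * I) • v ∈ B → f (A + ((t : ℂ) * I) • v) = f A)
    {A A' : E} (hA : A ∈ B) (hA' : A' ∈ B) : f A = f A' :=
  hB.is_const_of_fderiv_eq_zero hBc hf (fun _ hx => fderiv_eq_zero_of_realSliceSourced hB hf hS hinv hx) hA hA'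

/-- [folklore] **CONSTANCY ON A CHART BALL** (the shape of `analyticClass`: differentiability on `ball 0 R`). -/
theorem is_const_of_realSliceSourced_ball {R : ℝ} {f : E → ℂ} (hf : DifferentiableOn ℂ f (ball (0 : E) R)) {S : Set E}
    (hS : ∀ w : E, ∃ u ∈ S, ∃ v ∈ S, w = u + (I : ℂ) • v)
    (hinv : ∀ A ∈ ball (0 : E) R, ∀ v ∈ S, ∀ t : ℝ, A + ((t : ℂ) * I) • v ∈ ball (0 : E) R →
      f (A + ((t : ℂ) * I) • v) = f A)
    {A A' : E} (hA : A ∈ ball (0 : E) R) (hA' : A' ∈ ball (0 : E) R) : f A = f A' :=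
  is_const_of_realSliceSourced isOpen_ball (convex_ball (0 : E) R).isPreconnected hf hS hinv hA hA'

end Const

/-! ## §3 The row-NE9 corollary: real-slice-sourced members of the analytic class are background-constant -/

section NE9

variable {C : Carriers} {E : Type} [NormedAddCommGroup E] [NormedSpace ℂ E]

/-! A FAMILY `H : E → (doubleCarriers C).Dom → ℝ` over the complex chart is REAL-SLICE SOURCED (w.r.t. the real directions `S` and
the chart radii `R`) if on every chart ball BOTH its copies are invariant under the imaginary translations that stay in the ball:
`∀ X b, ∀ A ∈ ball 0 (R X), ∀ v ∈ S, ∀ t : ℝ, A + (t·I)•v ∈ ball 0 (R X) → H (A + (t·I)•v) (X, b) = H A (X, b)` — the shape of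
«`Ef g`, `act`, the marginal-free class built from a step that reads only REAL configurations» (kept inline; no `def … : Prop`). -/

/-- [folklore] The complex read-back of a real-slice-sourced family is real-slice sourced on each chart ball. -/
theorem realSliceSourced_lift {S : Set E} {R : C.Dom → ℝ} {H : E → (doubleCarriers C).Dom → ℝ}
    (h : ∀ (X : C.Dom) (b : Bool), ∀ A ∈ ball (0 : E) (R X), ∀ v ∈ S, ∀ t : ℝ,
      A + ((t : ℂ) * I) • v ∈ ball (0 : E) (R X) → H (A + ((t : ℂ) * I) • v) (X, b) = H A (X, b))
    (X : C.Dom) :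
    ∀ A ∈ ball (0 : E) (R X), ∀ v ∈ S, ∀ t : ℝ, A + ((t : ℂ) * I) • v ∈ ball (0 : E) (R X) →
      lift H X (A + ((t : ℂ) * I) • v) = lift H X A := by
  intro A hA v hv t ht
  apply Complex.ext
  · exact h X true A hA v hv t ht
  · exact h X false A hA v hv t ht

/-- [folklore] **THE NO-GO FOR THE CHEAP REPAIR OF THE BACKGROUND SLOT.**  A member `H` of the END's analytic class
`NE9Lemma1RemainderSpecies.analyticClass R` (chart functions ℂ-differentiable on the balls `‖A‖ < R X`) that is real-slice sourced
with respect to a real form `S` of the chart is BACKGROUND-CONSTANT on every chart ball, in both copies: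
`H A (X, b) = H A′ (X, b)`.  So if NE9's activity ∕ term functional on the complex chart were defined from the substrate's REAL-configuration
species by reading the real part of the chart point, the END's binders `hMF : MF ⊆ analyticClass D.R` + `hPinto` + `hAdm` would confine
the instantiation to families that do not depend on the background at all — the complexified species themselves are needed
([Balaban1985BackgroundPropagators] Sect. B, Theorem 3.4). -/
theorem analyticClass_const_of_realSliceSourced {S : Set E} (hS : ∀ w : E, ∃ u ∈ S, ∃ v ∈ S, w = u + (I : ℂ) • v)
    {R : C.Dom → ℝ} {H : E → (doubleCarriers C).Dom → ℝ} (hH : H ∈ analyticClass R)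
    (hsrc : ∀ (X : C.Dom) (b : Bool), ∀ A ∈ ball (0 : E) (R X), ∀ v ∈ S, ∀ t : ℝ,
      A + ((t : ℂ) * I) • v ∈ ball (0 : E) (R X) → H (A + ((t : ℂ) * I) • v) (X, b) = H A (X, b))
    (X : C.Dom) (b : Bool) {A A' : E} (hA : A ∈ ball (0 : E) (R X)) (hA' : A' ∈ ball (0 : E) (R X)) :
    H A (X, b) = H A' (X, b) := by
  have h := is_const_of_realSliceSourced_ball (hH X) hS (realSliceSourced_lift hsrc X) hA hA'
  cases b
  · exact congrArg Complex.im h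
  · exact congrArg Complex.re h

/-- [folklore] THE MODEL INSTANCE (chart `ι → ℂ`, the cheap repair literally): a family in the analytic class whose every copy
reads only the coordinatewise REAL PART of the chart point is background-constant on every chart ball. -/
theorem analyticClass_const_of_factor_re {ι : Type} [Fintype ι] {C : Carriers} {R : C.Dom → ℝ}
    (Hre : (ι → ℝ) → (doubleCarriers C).Dom → ℝ)
    (hH : (fun (w : ι → ℂ) (Xb : (doubleCarriers C).Dom) => Hre (fun i => (w i).re) Xb) ∈ analyticClass R) (X : C.Dom) (b : Bool)
    {A A' : ι → ℂ} (hA : A ∈ ball (0 : ι → ℂ) (R X)) (hA' : A' ∈ ball (0 : ι → ℂ) (R X)) :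
    Hre (fun i => (A i).re) (X, b) = Hre (fun i => (A' i).re) (X, b) := by
  have hsrc : ∀ (X' : C.Dom) (b' : Bool), ∀ A₁ ∈ ball (0 : ι → ℂ) (R X'),
      ∀ v ∈ Set.range (fun r : ι → ℝ => fun i => (r i : ℂ)), ∀ t : ℝ, A₁ + ((t : ℂ) * I) • v ∈ ball (0 : ι → ℂ) (R X') →
        (fun (w : ι → ℂ) (Xb : (doubleCarriers C).Dom) => Hre (fun i => (w i).re) Xb) (A₁ + ((t : ℂ) * I) • v) (X', b') =
          (fun (w : ι → ℂ) (Xb : (doubleCarriers C).Dom) => Hre (fun i => (w i).re) Xb) A₁ (X', b') := by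
    intro X' b' A₁ _ v hv t _
    obtain ⟨r, rfl⟩ := hv
    dsimp only
    congr 1
    funext i
    simp
  exact analyticClass_const_of_realSliceSourced (realForm_pi ι) hH hsrc X b hA hA'

end NE9

end Summit.QuantumFields.BalabanUV.T4Continuum.NE9RealSliceSourcingNoGo

end
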